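import Literature.NumberTheory.Transcendental.AyoubPeriodSeriesLocalizing
import Literature.NumberTheory.Transcendental.AyoubPeriodSeriesPiAlgebraic
import Literature.NumberTheory.Transcendental.AyoubPeriodSeriesKernel
import Literature.NumberTheory.Transcendental.AyoubPeriodSeriesProofs
import Summits.KontsevichZagierPeriods.KontsevichZagierPeriods.Theorems.UnfoldedStokesStokesGenerationStubSpanToRepsAuxCoeff

/-!
# `TypeAGeneration` (stmt-KontsevichZagierPeriods-18392) — same-variable certificates fail: the witness

cdisprove (refuter) negative lemmas for the crux `TypeAGeneration` of route
`KontsevichZagierPeriods/SymplecticScissors` (= the conjecture leaf `TypeAGenerationConjecture`,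
Ayoub 2015 Conj. 1.1 / Fresán 2024 Conj. 3.5, typed over `AyoubPeriodSeries.lean`). Part 1 of 2
(part 2: `Negative/SameVariables.lean`, the bridge to real functions and the negative lemma
`typeAGeneration_false_sameVariables`).

Contents (theorems only):
* §1 one-variable geometric germs `1/(u − z₀) = Σₙ u^{-(n+1)} z₀ⁿ` (Mathlib's
  `PowerSeries.invUnitsSub` renamed into the variable `z₀`): coefficients, membership in
  `𝒪_{k-alg}(𝔻̄^∞)` for `u` algebraic with `‖u‖ > 1`, and `∫₀¹ dz/(u − z) = −log(1 − u⁻¹)` (Mercator);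
* §2 `exists_witness`: the kernel element `F = 1/(2 + z₀) − 1/(3 − z₀) ∈ 𝒪_{ℚ-alg}(𝔻̄^∞)`, in the
  variable `z₀` only, `∫ F = log(3/2) + log(2/3) = 0` (the reflection relation
  `∫₀¹ φ(z) dz = ∫₀¹ φ(1 − z) dz`, `φ = 1/(2 + z)`), with its Taylor coefficients;
* §3 `relAC_eq_zero_of_dependsOnlyOnLT_one`: for `G` in `z₀` only and `i ≥ 1`,
  `∂G/∂zᵢ − G|_{zᵢ=1} + G|_{zᵢ=0} = 0` — Stokes in an unused direction is trivial.

References: Ayoub, Ann. of Math. 181 (2015), Conj. 1.1, Rem. 1.2, Rem. 1.5; Fresán, Journées X-UPS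
2024, Conj. 3.5, Rem. 3.6–3.7.
-/

noncomputable section

namespace Summit.KontsevichZagierPeriods.SymplecticScissors.TypeAGenerationNegative

open Set Finsupp
open Literature.NumberTheory.Transcendental
open Literature.NumberTheory.Transcendental.AyoubRel
open Summit.KontsevichZagierPeriods.KontsevichZagierPeriods.StokesGenerationLine

/-! ## §1 One-variable geometric germs `1/(u − z₀)` in `𝒪_{k-alg}(𝔻̄^∞)` -/

section Geo

open MvPowerSeries

variable (u : ℂˣ)

/-- Coefficient of `z₀ⁿ` in `1/(u − z₀)`: `u^{-(n+1)}`. [folklore] -/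
theorem coeff_geo_single (n : ℕ) :
    coeff (single 0 n) (rename (axisEmb 0) (PowerSeries.invUnitsSub u : MvPowerSeries Unit ℂ)) =
      ((u⁻¹ : ℂˣ) : ℂ) ^ (n + 1) := by
  have h := coeff_embDomain_rename (R := ℂ) (axisEmb 0)
    (PowerSeries.invUnitsSub u : MvPowerSeries Unit ℂ) (single () n)
  rw [embDomain_single, axisEmb_apply] at h
  rw [h]
  change PowerSeries.coeff n (PowerSeries.invUnitsSub u) = _
  rw [PowerSeries.coeff_invUnitsSub, one_divp, ← inv_pow, Units.val_pow_eq_pow_val]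

/-- Off the `z₀`-axis the coefficients of `1/(u − z₀)` vanish. [folklore] -/
theorem coeff_geo_of_ne {x : ℕ →₀ ℕ} (hx : ∀ n, x ≠ single 0 n) :
    coeff x (rename (axisEmb 0) (PowerSeries.invUnitsSub u : MvPowerSeries Unit ℂ)) = 0 := by
  apply coeff_rename_eq_zero
  rintro ⟨y, hy⟩
  apply hx (y ())
  rw [← hy]
  conv_lhs => rw [unique_single y]
  rw [mapDomain_single]
  rfl

/-- `1/(u − z₀)` depends only on `z₀`. [folklore] -/
theorem dependsOnlyOnLT_geo :
    DependsOnlyOnLT (rename (axisEmb 0) (PowerSeries.invUnitsSub u : MvPowerSeries Unit ℂ)) 1 := by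
  rintro a ⟨i, hi, hai⟩
  refine coeff_geo_of_ne u fun n hn => hai ?_
  rw [hn, single_apply, if_neg]
  omega

/-- `1/(u − z₀)` has polyradius `‖u‖ > 1` when `‖u⁻¹‖ < 1`: with `r = 2/(1 + ‖u⁻¹‖) > 1` the weighted
coefficient series is geometric. [folklore] -/
theorem hasPolyradiusGtOne_geo (hu : ‖((u⁻¹ : ℂˣ) : ℂ)‖ < 1) :
    HasPolyradiusGtOne (rename (axisEmb 0) (PowerSeries.invUnitsSub u : MvPowerSeries Unit ℂ)) := by
  set ρ : ℝ := ‖((u⁻¹ : ℂˣ) : ℂ)‖ with hρdef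
  have hρ0 : 0 ≤ ρ := norm_nonneg _
  set r : ℝ := 2 / (1 + ρ) with hr
  have hr1 : 1 < r := by
    rw [hr, lt_div_iff₀ (by linarith)]
    linarith
  have hρr : ρ * r < 1 := by
    rw [hr, mul_div_assoc', div_lt_one (by linarith)]
    linarith
  have hρr0 : 0 ≤ ρ * r := by positivity
  refine ⟨r, hr1, ?_⟩
  have key : Summable ((fun a : ℕ →₀ ℕ =>
      ‖coeff a (rename (axisEmb 0) (PowerSeries.invUnitsSub u : MvPowerSeries Unit ℂ))‖ *
        r ^ degree a) ∘ (single 0 : ℕ → ℕ →₀ ℕ)) := by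
    have e : ((fun a : ℕ →₀ ℕ =>
        ‖coeff a (rename (axisEmb 0) (PowerSeries.invUnitsSub u : MvPowerSeries Unit ℂ))‖ *
          r ^ degree a) ∘ (single 0 : ℕ → ℕ →₀ ℕ)) = fun n => ρ * (ρ * r) ^ n := by
      funext n
      simp only [Function.comp_apply]
      rw [coeff_geo_single, degree_single, norm_pow, pow_succ, mul_pow]
      ring
    rw [e]
    exact (summable_geometric_of_lt_one hρr0 hρr).mul_left ρ
  refine (Function.Injective.summable_iff (single_injective 0) ?_).mp key
  intro x hx
  rw [coeff_geo_of_ne, norm_zero, zero_mul]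
  intro n hn
  exact hx ⟨n, hn.symm⟩

/-- `(1/(u − z₀)) · (u − z₀) = 1`. [folklore] -/
theorem geo_mul_C_sub_X :
    rename (axisEmb 0) (PowerSeries.invUnitsSub u : MvPowerSeries Unit ℂ) * (C (u : ℂ) - X 0) = 1 := by
  have h : (PowerSeries.invUnitsSub u : MvPowerSeries Unit ℂ) *
      (MvPowerSeries.C (u : ℂ) - MvPowerSeries.X ()) = 1 :=
    PowerSeries.invUnitsSub_mul_sub u
  have h' := congrArg (MvPowerSeries.rename (R := ℂ) (axisEmb 0)) h
  rw [map_mul, map_sub, map_one, rename_axisEmb_C, rename_axisEmb_X] at h'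
  exact h'

/-- `1/(u − z₀)` is algebraic over `k(z)` when `u` is algebraic over `k`. [folklore] -/
theorem isAlgebraicOverRatFunc_geo {k : Type} [Field k] (σ : k →+* ℂ)
    (hu : ∃ p : Polynomial k, p ≠ 0 ∧ Polynomial.eval₂ σ (u : ℂ) p = 0) :
    IsAlgebraicOverRatFunc σ (rename (axisEmb 0) (PowerSeries.invUnitsSub u : MvPowerSeries Unit ℂ)) := by
  letI : Algebra (MvPolynomial ℕ k) CSeries := (polyToCSeries σ).toAlgebra
  have hu' : IsAlgebraicOverRatFunc σ (C (u : ℂ) - X 0 : CSeries) := by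
    rw [sub_eq_add_neg]
    exact (isAlgebraicOverRatFunc_C σ hu).add σ ((isAlgebraicOverRatFunc_X σ 0).neg σ)
  letI : Invertible (C (u : ℂ) - X 0 : CSeries) :=
    ⟨_, geo_mul_C_sub_X u, by rw [mul_comm]; exact geo_mul_C_sub_X u⟩
  exact ((isAlgebraicOverRatFunc_iff_isAlgebraic σ _).mp hu').invOf

/-- `1/(u − z₀) ∈ 𝒪_{k-alg}(𝔻̄^∞)` for `u` algebraic over `k` with `‖u‖ > 1`.
[cite: AyoubRelKZRevisited, §1.1] -/
theorem geo_mem_Oan {k : Type} [Field k] (σ : k →+* ℂ)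
    (hu : ∃ p : Polynomial k, p ≠ 0 ∧ Polynomial.eval₂ σ (u : ℂ) p = 0)
    (hu1 : ‖((u⁻¹ : ℂˣ) : ℂ)‖ < 1) :
    rename (axisEmb 0) (PowerSeries.invUnitsSub u : MvPowerSeries Unit ℂ) ∈ Oan σ :=
  ⟨⟨1, dependsOnlyOnLT_geo u⟩, hasPolyradiusGtOne_geo u hu1, isAlgebraicOverRatFunc_geo u σ hu⟩

/-- `∫₀¹ dz/(u − z) = Σₙ u^{-(n+1)}/(n+1) = −log(1 − u⁻¹)` (Mercator). [folklore] -/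
theorem intC_geo (hu1 : ‖((u⁻¹ : ℂˣ) : ℂ)‖ < 1) :
    intC (rename (axisEmb 0) (PowerSeries.invUnitsSub u : MvPowerSeries Unit ℂ)) =
      -Complex.log (1 - ((u⁻¹ : ℂˣ) : ℂ)) := by
  have h1 : HasSum (fun n : ℕ => ((u⁻¹ : ℂˣ) : ℂ) ^ (n + 1) * ((n : ℂ) + 1)⁻¹)
      (-Complex.log (1 - ((u⁻¹ : ℂˣ) : ℂ))) := by
    have h := (hasSum_nat_add_iff' 1).mpr (Complex.hasSum_taylorSeries_neg_log hu1)
    simp only [Finset.range_one, Finset.sum_singleton, pow_zero, Nat.cast_zero, div_zero,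
      sub_zero] at h
    simp only [Nat.cast_add, Nat.cast_one, div_eq_mul_inv] at h
    exact h
  rw [intC, ← h1.tsum_eq]
  have h2 := Function.Injective.tsum_eq (single_injective 0)
    (f := fun a : ℕ →₀ ℕ =>
      coeff a (rename (axisEmb 0) (PowerSeries.invUnitsSub u : MvPowerSeries Unit ℂ)) *
        ∏ j ∈ a.support, ((a j : ℂ) + 1)⁻¹) (fun a ha => by
      by_contra hra
      apply ha
      change coeff a (rename (axisEmb 0) (PowerSeries.invUnitsSub u : MvPowerSeries Unit ℂ)) *
        ∏ j ∈ a.support, ((a j : ℂ) + 1)⁻¹ = 0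
      rw [coeff_geo_of_ne u (fun n hn => hra ⟨n, hn.symm⟩), zero_mul])
  rw [← h2]
  refine tsum_congr fun n => ?_
  rw [coeff_geo_single, intWeight_single]

end Geo

/-! ## §2 The kernel element `F = 1/(2 + z₀) − 1/(3 − z₀)` -/

section Witness

open MvPowerSeries

/-- **The witness.** There is `F ∈ 𝒪_{ℚ-alg}(𝔻̄^∞)` depending on `z₀` only, with `∫ F = 0`, whose
Taylor coefficients are those of `1/(2 + z) − 1/(3 − z)`: `½(−½)ⁿ − ⅓(⅓)ⁿ` on the axis, `0` off it
(`F = −1/((−2) − z₀) − 1/(3 − z₀)`, two geometric germs; `∫ F = log(3/2) + log(2/3) = 0`).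
[cite: Ayoub2015, Rem. 1.5] -/
theorem exists_witness :
    ∃ F : CSeries, F ∈ Oan (algebraMap ℚ ℂ) ∧ DependsOnlyOnLT F 1 ∧ intC F = 0 ∧
      (∀ n : ℕ, coeff (single 0 n) F =
        (((1 / 2 : ℝ) * (-1 / 2) ^ n - (1 / 3) * (1 / 3) ^ n : ℝ) : ℂ)) ∧
      (∀ b : ℕ →₀ ℕ, (∀ n, b ≠ single 0 n) → coeff b F = 0) := by
  set u₁ : ℂˣ := Units.mk0 (-2 : ℂ) (by norm_num) with hu₁
  set u₂ : ℂˣ := Units.mk0 (3 : ℂ) (by norm_num) with hu₂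
  have hi₁ : ((u₁⁻¹ : ℂˣ) : ℂ) = -1 / 2 := by
    rw [Units.val_inv_eq_inv_val, hu₁, Units.val_mk0]; norm_num
  have hi₂ : ((u₂⁻¹ : ℂˣ) : ℂ) = 1 / 3 := by
    rw [Units.val_inv_eq_inv_val, hu₂, Units.val_mk0]; norm_num
  have hn₁ : ‖((u₁⁻¹ : ℂˣ) : ℂ)‖ < 1 := by rw [hi₁]; norm_num
  have hn₂ : ‖((u₂⁻¹ : ℂˣ) : ℂ)‖ < 1 := by rw [hi₂]; norm_num
  have ha₁ : ∃ p : Polynomial ℚ, p ≠ 0 ∧ Polynomial.eval₂ (algebraMap ℚ ℂ) (u₁ : ℂ) p = 0 :=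
    ⟨Polynomial.X - Polynomial.C (-2), Polynomial.X_sub_C_ne_zero _, by
      rw [hu₁, Units.val_mk0]; simp⟩
  have ha₂ : ∃ p : Polynomial ℚ, p ≠ 0 ∧ Polynomial.eval₂ (algebraMap ℚ ℂ) (u₂ : ℂ) p = 0 :=
    ⟨Polynomial.X - Polynomial.C 3, Polynomial.X_sub_C_ne_zero _, by
      rw [hu₂, Units.val_mk0]; simp⟩
  set g₁ : CSeries := rename (axisEmb 0) (PowerSeries.invUnitsSub u₁ : MvPowerSeries Unit ℂ) with hg₁
  set g₂ : CSeries := rename (axisEmb 0) (PowerSeries.invUnitsSub u₂ : MvPowerSeries Unit ℂ) with hg₂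
  have hm₁ : g₁ ∈ Oan (algebraMap ℚ ℂ) := geo_mem_Oan u₁ _ ha₁ hn₁
  have hm₂ : g₂ ∈ Oan (algebraMap ℚ ℂ) := geo_mem_Oan u₂ _ ha₂ hn₂
  refine ⟨-g₁ - g₂, sub_mem_Oan _ (neg_mem_Oan _ hm₁) hm₂, ?_, ?_, ?_, ?_⟩
  · intro a ha
    rw [map_sub, map_neg, dependsOnlyOnLT_geo u₁ a ha, dependsOnlyOnLT_geo u₂ a ha]
    simp
  · rw [intC_sub (summable_norm_coeff_of_mem_Oan _ (neg_mem_Oan _ hm₁))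
      (summable_norm_coeff_of_mem_Oan _ hm₂), ← neg_one_smul ℂ g₁, intC_smul,
      hg₁, hg₂, intC_geo u₁ hn₁, intC_geo u₂ hn₂, hi₁, hi₂]
    have e1 : (1 - (-1 / 2) : ℂ) = ((3 / 2 : ℝ) : ℂ) := by push_cast; ring
    have e2 : (1 - 1 / 3 : ℂ) = ((2 / 3 : ℝ) : ℂ) := by push_cast; ring
    rw [e1, e2, ← Complex.ofReal_log (by norm_num), ← Complex.ofReal_log (by norm_num)]
    have h : Real.log (3 / 2) + Real.log (2 / 3) = 0 := by
      rw [← Real.log_mul (by norm_num) (by norm_num)]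
      norm_num
    have h' : (Real.log (2 / 3) : ℂ) = -(Real.log (3 / 2) : ℂ) := by
      rw [← Complex.ofReal_neg]
      congr 1
      linarith
    rw [h']
    ring
  · intro n
    rw [map_sub, map_neg, hg₁, hg₂, coeff_geo_single, coeff_geo_single, hi₁, hi₂]
    push_cast
    ring
  · intro b hb
    rw [map_sub, map_neg, hg₁, hg₂, coeff_geo_of_ne u₁ hb, coeff_geo_of_ne u₂ hb]
    simp

end Witness

/-! ## §3 One-variable certificates: directions `i ≥ 1` are trivial -/

section OneVariable

open MvPowerSeries

/-- For `G` depending on `z₀` only and `i ≥ 1`, the restriction `G|_{zᵢ = c}` is `G`. [folklore] -/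
theorem restrC_eq_self_of_dependsOnlyOnLT_one {G : CSeries} (hG : DependsOnlyOnLT G 1) {i : ℕ}
    (hi : 1 ≤ i) (c : ℂ) : restrC i c G = G := by
  ext a
  rw [coeff_restrC]
  split_ifs with h0
  · rw [tsum_eq_single 0]
    · simp
    · intro n hn
      rw [hG (a + single i n) ⟨i, hi, ?_⟩, zero_mul]
      rw [Finsupp.add_apply, single_eq_same, h0, zero_add]
      exact hn
  · exact (hG a ⟨i, hi, h0⟩).symm

/-- For `G` depending on `z₀` only and `i ≥ 1`, `∂G/∂zᵢ = 0`. [folklore] -/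
theorem pdz_eq_zero_of_dependsOnlyOnLT_one {G : CSeries} (hG : DependsOnlyOnLT G 1) {i : ℕ}
    (hi : 1 ≤ i) : pdz i G = 0 := by
  ext a
  rw [coeff_pdz, hG (a + single i 1) ⟨i, hi, ?_⟩, mul_zero, map_zero]
  rw [Finsupp.add_apply, single_eq_same]
  omega

/-- **Stokes in a direction the certificate does not involve is trivial**: for `G` in the
variable `z₀` only and `i ≥ 1`, `∂G/∂zᵢ − G|_{zᵢ=1} + G|_{zᵢ=0} = 0`. [cite: Ayoub2015, Rem. 1.2] -/
theorem relAC_eq_zero_of_dependsOnlyOnLT_one {G : CSeries} (hG : DependsOnlyOnLT G 1) {i : ℕ}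
    (hi : 1 ≤ i) : relAC i G = 0 := by
  rw [relAC, pdz_eq_zero_of_dependsOnlyOnLT_one hG hi,
    restrC_eq_self_of_dependsOnlyOnLT_one hG hi, restrC_eq_self_of_dependsOnlyOnLT_one hG hi]
  abel

end OneVariable

end Summit.KontsevichZagierPeriods.SymplecticScissors.TypeAGenerationNegative
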